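import Summits.BirchSwinnertonDyer.BirchSwinnertonDyer.Theorems.ResidualThetaTransportAtTwoPlusDualThetaAlgebra
import Summits.BirchSwinnertonDyer.BirchSwinnertonDyer.Theorems.ResidualThetaTransportAtTwoPlusDualLayerNorms
import HarnessLib

/-!
# The SOCLE of `Λ/(ω_n, p^J)`: every element outside the ideal `I(n,J) = (ω_n) + (p^J)` has a multiple congruent to the socle
# generator `p^{J−1}·ν_{n/0}` (`ν_{n/0} = ω_n/T = ∑_{i<pⁿ}(1+T)ⁱ`) — the ring-theoretic input of the CYCLICITY of the layers
# `S[p^J, ω_n]` of a cofree rank-one dual pair (θ-extraction for the ISO θ-plan)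

Routes `ResidualThetaTransportAtTwo` (RTT, crux r201 `ResidualLambdaFormulaNegDiscAtTwo`, stmt-BirchSwinnertonDyer-23110) /
`ThetaPartnerAtTwo`. Seat `prover-bsd-wall-tp2-p2x-w3` g13; `--supports stmt-BirchSwinnertonDyer-23110 --as helper`. THEOREMS ONLY (no
definition, no named fact, no instance, no `sorry`); PURE ALGEBRA in `Λ = ℤ_p⟦T⟧`; closes nothing.

WHY. The θ-plan for ISO (w2 g15/g16, lead g12) encodes the layer pairing on `S_n = S[2^J, ω_n]` by ONE element `θ_n ∈ Λ/(2^J, ω_n)`;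
this needs `S_n` to be a CYCLIC `ℤ[φ]`-module («`H_n[2^J] ≅ ℤ/2^J[C_{2^n}]` free of rank 1»). `R_n = Λ/(p^J, ω_n)` is a local
Artinian ring with simple socle spanned by `p^{J−1}ν_{n/0}`; the lemma below is the statement «every non-zero principal ideal of `R_n`
contains the socle», in lift-friendly form.
* `C_pow_dvd_of_coe_mul_dvd` — `D·α ∈ p^kΛ ⟹ α ∈ p^kΛ` for distinguished `D` (iterate `C_dvd_of_coe_mul_dvd`);
* `mem_omegaIdeal_of_geom_sum_mul_mem` — the COLON IDEAL `(I(m,J) : ν_{m/n}) = I(n,J)` (`ν_{m/n} = ω_m/ω_n`);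
* `C_dvd_geom_sum_sub_X_pow` — `ν_{n/0} − T^{pⁿ−1} ∈ pΛ`;
* **`socle_mem_span_sup_omegaIdeal`** — `P ∉ I(n,J)`, `1 ≤ J` ⟹ `p^{J−1}·T^{pⁿ−1} ∈ (P) + I(n,J)` (and hence `p^{J−1}ν_{n/0}` too).

HONEST FRAMING: closes nothing; ISO / 23110 NOT proved; BSD is not proved by any of this.
References: [BDKim2007] Prop. 3.15 (proof, pp. 56–57); [Washington1997] §7.1, §13.2; [Lang1990] Ch. 5 §1–2.
-/

set_option autoImplicit false
-- D-0017: single-problem summit, so `Summit.BirchSwinnertonDyer.BirchSwinnertonDyer.…` repeats a namespace BY DESIGN.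
set_option linter.dupNamespace false

noncomputable section

open scoped Classical
open Polynomial Literature.NumberTheory.EllipticCurves

namespace Summit.BirchSwinnertonDyer.BirchSwinnertonDyer.Theorems.ResidualThetaLayer.PlusDual

section Socle

variable (p : ℕ) [hp : Fact p.Prime]

/-- `D·α ∈ p^kΛ ⟹ α ∈ p^kΛ` for a distinguished `D` (iterated cancellation modulo `p`). [cite: Washington1997, §7.1 (Prop. 7.2)] -/
theorem C_pow_dvd_of_coe_mul_dvd {D : ℤ_[p][X]} (hD : D.IsDistinguishedAt (IsLocalRing.maximalIdeal ℤ_[p])) (k : ℕ)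
    {α : PowerSeries ℤ_[p]} (h : PowerSeries.C ((p : ℤ_[p]) ^ k) ∣ (D : PowerSeries ℤ_[p]) * α) :
    PowerSeries.C ((p : ℤ_[p]) ^ k) ∣ α := by
  have hCp : (PowerSeries.C (p : ℤ_[p]) : PowerSeries ℤ_[p]) ≠ 0 := by
    intro h0
    have := congrArg PowerSeries.constantCoeff h0
    rw [PowerSeries.constantCoeff_C, map_zero] at this
    exact (Nat.cast_ne_zero.mpr hp.out.ne_zero) this
  induction k generalizing α with
  | zero => rw [pow_zero, map_one]; exact one_dvd _
  | succ k ih =>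
    -- first `p ∣ α`
    have h1 : PowerSeries.C (p : ℤ_[p]) ∣ (D : PowerSeries ℤ_[p]) * α :=
      (Dvd.intro _ (by rw [pow_succ', map_mul])).trans h
    obtain ⟨β, rfl⟩ := C_dvd_of_coe_mul_dvd p hD h1
    -- cancel one `p` and induct
    obtain ⟨γ, hγ⟩ := h
    rw [pow_succ', map_mul, mul_left_comm, mul_assoc] at hγ
    have h2 : (D : PowerSeries ℤ_[p]) * β = PowerSeries.C ((p : ℤ_[p]) ^ k) * γ := mul_left_cancel₀ hCp hγ
    obtain ⟨δ, rfl⟩ := ih ⟨γ, h2⟩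
    exact ⟨δ, by rw [pow_succ', map_mul, mul_assoc]⟩

/-- **The colon ideal `(I(m,J) : ν_{m/n}) = I(n,J)`**: if `ν_{m/n}·x ∈ (ω_m) + (p^J)` then `x ∈ (ω_n) + (p^J)` (`ω_m = ω_n ν_{m/n}` and
`ν_{m/n}` is distinguished, hence a non-zero-divisor modulo `p^J`). [cite: Washington1997, §7.1 and §13.2] -/
theorem mem_omegaIdeal_of_geom_sum_mul_mem (J : ℕ) {n m : ℕ} (hnm : n ≤ m) {x : PowerSeries ℤ_[p]}
    (hx : ((∑ i ∈ Finset.range (p ^ (m - n)), ((X + 1 : ℤ_[p][X]) ^ p ^ n) ^ i : ℤ_[p][X]) : PowerSeries ℤ_[p]) * x ∈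
      Ideal.span {(((X + 1 : ℤ_[p][X]) ^ p ^ m - 1 : ℤ_[p][X]) : PowerSeries ℤ_[p])} ⊔
        Ideal.span {PowerSeries.C ((p : ℤ_[p]) ^ J)}) :
    x ∈ Ideal.span {(((X + 1 : ℤ_[p][X]) ^ p ^ n - 1 : ℤ_[p][X]) : PowerSeries ℤ_[p])} ⊔
      Ideal.span {PowerSeries.C ((p : ℤ_[p]) ^ J)} := by
  obtain ⟨a, b, hab⟩ := mem_span_sup_span_iff.mp hx
  have hfac := congrArg (fun P : ℤ_[p][X] ↦ (P : PowerSeries ℤ_[p])) (omega_eq_omega_mul_geom_sum (p := p) hnm)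
  simp only [Polynomial.coe_mul] at hfac
  rw [hfac] at hab
  -- `ν·(x − ω_n a) = p^J b`
  have h1 : ((∑ i ∈ Finset.range (p ^ (m - n)), ((X + 1 : ℤ_[p][X]) ^ p ^ n) ^ i : ℤ_[p][X]) : PowerSeries ℤ_[p]) *
      (x - (((X + 1 : ℤ_[p][X]) ^ p ^ n - 1 : ℤ_[p][X]) : PowerSeries ℤ_[p]) * a) = PowerSeries.C ((p : ℤ_[p]) ^ J) * b := by
    linear_combination hab
  obtain ⟨c, hc⟩ := C_pow_dvd_of_coe_mul_dvd p (isDistinguishedAt_geom_sum (p := p) hnm).1 J ⟨b, h1⟩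
  exact mem_span_sup_span_iff.mpr ⟨a, c, by linear_combination hc⟩

/-- `ν_{n/0} − T^{pⁿ−1} ∈ pΛ` (`T·ν_{n/0} = ω_n ≡ T^{pⁿ}` modulo `p`; cancel `T` in `𝔽_p⟦T⟧`). [cite: Washington1997, §7.1] -/
theorem C_dvd_geom_sum_sub_X_pow (n : ℕ) :
    PowerSeries.C (p : ℤ_[p]) ∣ (∑ i ∈ Finset.range (p ^ n), (1 + PowerSeries.X : PowerSeries ℤ_[p]) ^ i) -
      (PowerSeries.X : PowerSeries ℤ_[p]) ^ (p ^ n - 1) := by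
  rw [← map_residue_eq_zero_iff_C_dvd]
  set red := PowerSeries.map (Ideal.Quotient.mk (IsLocalRing.maximalIdeal ℤ_[p])) with hred
  have hpn : 1 ≤ p ^ n := Nat.one_le_pow _ _ hp.out.pos
  -- `T·ν = ω_n`, reduced: `T · red ν = T^{pⁿ} = T · T^{pⁿ−1}`
  have hων : (PowerSeries.X : PowerSeries ℤ_[p]) * ∑ i ∈ Finset.range (p ^ n), (1 + PowerSeries.X : PowerSeries ℤ_[p]) ^ i =
      (((X + 1 : ℤ_[p][X]) ^ p ^ n - 1 : ℤ_[p][X]) : PowerSeries ℤ_[p]) := by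
    rw [UniversalToricDescentTorsionFreeByCount.coe_omega p, mul_comm, ← geom_sum_mul, add_sub_cancel_left]
  have h1 : PowerSeries.X * red (∑ i ∈ Finset.range (p ^ n), (1 + PowerSeries.X : PowerSeries ℤ_[p]) ^ i) =
      PowerSeries.X * PowerSeries.X ^ (p ^ n - 1) := by
    have := congrArg red hων
    rw [map_mul, PowerSeries.map_X, map_residue_coe_eq_X_pow p (Kato2004.IwasawaH1Exists.isDistinguishedAt_omega p n),
      UniversalToricDescentTorsionFreeByCount.natDegree_omega p] at this
    rw [this, ← pow_succ', Nat.sub_add_cancel hpn]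
  have h2 := mul_left_cancel₀ PowerSeries.X_ne_zero h1
  rw [map_sub, h2, map_pow, PowerSeries.map_X, sub_self]

/-- **The socle lemma: every element outside `I(n,J) = (ω_n) + (p^J)` has a multiple `≡ p^{J−1}·T^{pⁿ−1} (mod I(n,J))`** (`1 ≤ J`).
Write `P ≡ p^a P₁` with `a < J` maximal; then some coefficient of `P₁` below `T^{pⁿ}` is a unit, so `P₁ = T^b·U + p·t` with `U ∈ Λˣ`,
`b < pⁿ`, and `p^{J−1−a}·T^{pⁿ−1−b}·U⁻¹·P ≡ p^{J−1}T^{pⁿ−1}`. (In `R_n = Λ/I(n,J)`: every non-zero ideal contains the simple socle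
`p^{J−1}T^{pⁿ−1}·𝔽_p`.) [cite: Washington1997, §7.1 and §13.2] [cite: Lang1990, Ch. 5 §2] -/
theorem socle_mem_span_sup_omegaIdeal {J : ℕ} (hJ : 1 ≤ J) (n : ℕ) {P : PowerSeries ℤ_[p]}
    (hP : P ∉ Ideal.span {(((X + 1 : ℤ_[p][X]) ^ p ^ n - 1 : ℤ_[p][X]) : PowerSeries ℤ_[p])} ⊔
      Ideal.span {PowerSeries.C ((p : ℤ_[p]) ^ J)}) :
    PowerSeries.C ((p : ℤ_[p]) ^ (J - 1)) * (PowerSeries.X : PowerSeries ℤ_[p]) ^ (p ^ n - 1) ∈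
      Ideal.span {P} ⊔ (Ideal.span {(((X + 1 : ℤ_[p][X]) ^ p ^ n - 1 : ℤ_[p][X]) : PowerSeries ℤ_[p])} ⊔
        Ideal.span {PowerSeries.C ((p : ℤ_[p]) ^ J)}) := by
  set ω : PowerSeries ℤ_[p] := (((X + 1 : ℤ_[p][X]) ^ p ^ n - 1 : ℤ_[p][X]) : PowerSeries ℤ_[p]) with hωdef
  set I : Ideal (PowerSeries ℤ_[p]) := Ideal.span {ω} ⊔ Ideal.span {PowerSeries.C ((p : ℤ_[p]) ^ J)} with hI
  have hpJ_mem : ∀ y, PowerSeries.C ((p : ℤ_[p]) ^ J) * y ∈ I := fun y ↦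
    Submodule.mem_sup_right (Ideal.mul_mem_right _ _ (Ideal.mem_span_singleton_self _))
  have hω_mem : ∀ y, ω * y ∈ I := fun y ↦ Submodule.mem_sup_left (Ideal.mul_mem_right _ _ (Ideal.mem_span_singleton_self _))
  -- (i) the maximal `a < J` with `P ∈ (p^a) + I`
  let Q : ℕ → Prop := fun a ↦ ∃ P₁ : PowerSeries ℤ_[p], P - PowerSeries.C ((p : ℤ_[p]) ^ a) * P₁ ∈ I
  have hQ0 : Q 0 := ⟨P, by rw [pow_zero, map_one, one_mul, sub_self]; exact I.zero_mem⟩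
  have hQJ : ¬ Q J := by
    rintro ⟨P₁, h1⟩
    exact hP (by simpa using I.add_mem h1 (hpJ_mem P₁))
  set a := Nat.findGreatest Q (J - 1) with ha
  have hQa : Q a := Nat.findGreatest_spec (Nat.zero_le _) hQ0
  have haJ : a ≤ J - 1 := Nat.findGreatest_le _
  have hnot : ¬ Q (a + 1) := by
    by_cases h : a + 1 ≤ J - 1
    · exact Nat.findGreatest_is_greatest (Nat.lt_succ_self a) h
    · have : a + 1 = J := by omega
      rw [this]; exact hQJ
  obtain ⟨P₁, hP₁⟩ := hQa
  -- (ii) some coefficient of `P₁` below `pⁿ` is a unit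
  have hex : ∃ i, PowerSeries.coeff i P₁ ∉ IsLocalRing.maximalIdeal ℤ_[p] := by
    by_contra hall
    push Not at hall
    -- then `P₁ ∈ pΛ`, so `P ∈ (p^{a+1}) + I`
    have hdvd : PowerSeries.C (p : ℤ_[p]) ∣ P₁ := by
      rw [PowerSeries.C_dvd_iff_forall_dvd_coeff]
      intro i
      have := hall i
      rwa [PadicInt.maximalIdeal_eq_span_p, Ideal.mem_span_singleton] at this
    obtain ⟨P₂, rfl⟩ := hdvd
    exact hnot ⟨P₂, by rwa [pow_succ, map_mul, mul_assoc]⟩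
  set b := Nat.find hex with hb
  have hbunit : PowerSeries.coeff b P₁ ∉ IsLocalRing.maximalIdeal ℤ_[p] := Nat.find_spec hex
  have hbmin : ∀ i < b, PowerSeries.coeff i P₁ ∈ IsLocalRing.maximalIdeal ℤ_[p] := fun i hi ↦ by
    have := Nat.find_min hex hi; push Not at this; exact this
  -- `b < pⁿ`: otherwise `P₁ ∈ (T^{pⁿ}) + (p) ⊆ (ω_n) + (p)` and again `P ∈ (p^{a+1}) + I`
  have hbn : b < p ^ n := by
    by_contra hge
    push Not at hge
    have hsplit := PowerSeries.eq_X_pow_mul_shift_add_trunc (p ^ n) P₁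
    have htr : PowerSeries.C (p : ℤ_[p]) ∣ ((PowerSeries.trunc (p ^ n) P₁ : ℤ_[p][X]) : PowerSeries ℤ_[p]) := by
      rw [PowerSeries.C_dvd_iff_forall_dvd_coeff]
      intro i
      rw [Polynomial.coeff_coe, PowerSeries.coeff_trunc]
      split_ifs with hi
      · have := hbmin i (lt_of_lt_of_le hi hge)
        rwa [PadicInt.maximalIdeal_eq_span_p, Ideal.mem_span_singleton] at this
      · exact dvd_zero _
    obtain ⟨t, ht⟩ := htr
    obtain ⟨w, hw⟩ := C_dvd_X_pow_sub_omega p n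
    -- `P₁ = T^{pⁿ} s + p t = ω s + p (w s + t)`
    set sft := PowerSeries.mk fun i ↦ PowerSeries.coeff (i + p ^ n) P₁ with hsft
    have hXn : (PowerSeries.X : PowerSeries ℤ_[p]) ^ p ^ n = ω + PowerSeries.C (p : ℤ_[p]) * w := by
      rw [← hw, add_sub_cancel]
    have hP₁eq : P₁ = ω * sft + PowerSeries.C (p : ℤ_[p]) * (w * sft + t) := by
      rw [hsplit, ht, hXn]; ring
    refine hnot ⟨w * sft + t, ?_⟩
    have : P - PowerSeries.C ((p : ℤ_[p]) ^ (a + 1)) * (w * sft + t) =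
        (P - PowerSeries.C ((p : ℤ_[p]) ^ a) * P₁) + ω * (PowerSeries.C ((p : ℤ_[p]) ^ a) * sft) := by
      rw [hP₁eq, pow_succ, map_mul]; ring
    rw [this]
    exact I.add_mem hP₁ (hω_mem _)
  -- (iii) `P₁ = T^b U + p t` with `U` a unit
  have hsplit := PowerSeries.eq_X_pow_mul_shift_add_trunc b P₁
  set U := PowerSeries.mk fun i ↦ PowerSeries.coeff (i + b) P₁ with hUdef
  have hUunit : IsUnit U := by
    rw [PowerSeries.isUnit_iff_constantCoeff, ← PowerSeries.coeff_zero_eq_constantCoeff_apply, hUdef, PowerSeries.coeff_mk, zero_add]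
    by_contra hnu
    exact hbunit ((IsLocalRing.mem_maximalIdeal _).mpr (mem_nonunits_iff.mpr hnu))
  have htr : PowerSeries.C (p : ℤ_[p]) ∣ ((PowerSeries.trunc b P₁ : ℤ_[p][X]) : PowerSeries ℤ_[p]) := by
    rw [PowerSeries.C_dvd_iff_forall_dvd_coeff]
    intro i
    rw [Polynomial.coeff_coe, PowerSeries.coeff_trunc]
    split_ifs with hi
    · have := hbmin i hi
      rwa [PadicInt.maximalIdeal_eq_span_p, Ideal.mem_span_singleton] at this
    · exact dvd_zero _
  obtain ⟨t, ht⟩ := htr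
  have hP1 : P₁ = (PowerSeries.X : PowerSeries ℤ_[p]) ^ b * U + PowerSeries.C (p : ℤ_[p]) * t := by rw [← ht]; exact hsplit
  -- (iv) assemble: `p^{J−1−a}·T^{pⁿ−1−b}·U⁻¹·P ≡ p^{J−1}T^{pⁿ−1}`
  set Ui : PowerSeries ℤ_[p] := ↑(hUunit.unit⁻¹) with hUidef
  have hUi : U * Ui = 1 := hUunit.mul_val_inv
  obtain ⟨d, hd⟩ : ∃ d, J - 1 = a + d := ⟨J - 1 - a, by omega⟩
  obtain ⟨c, hc⟩ : ∃ c, p ^ n - 1 = b + c := ⟨p ^ n - 1 - b, by omega⟩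
  have e3 : PowerSeries.C ((p : ℤ_[p]) ^ (a + d)) * PowerSeries.C (p : ℤ_[p]) = PowerSeries.C ((p : ℤ_[p]) ^ J) := by
    rw [← map_mul, ← pow_succ, show a + d + 1 = J by omega]
  rw [hd, hc]
  have key : PowerSeries.C ((p : ℤ_[p]) ^ (a + d)) * (PowerSeries.X : PowerSeries ℤ_[p]) ^ (b + c) =
      (PowerSeries.X ^ c * Ui * PowerSeries.C ((p : ℤ_[p]) ^ d)) * P -
        (PowerSeries.X ^ c * Ui * PowerSeries.C ((p : ℤ_[p]) ^ d)) * (P - PowerSeries.C ((p : ℤ_[p]) ^ a) * P₁) -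
          PowerSeries.C ((p : ℤ_[p]) ^ J) * (PowerSeries.X ^ c * Ui * t) := by
    rw [hP1, ← e3]
    simp only [map_pow]
    linear_combination (-(PowerSeries.C (p : ℤ_[p])) ^ (a + d) * (PowerSeries.X : PowerSeries ℤ_[p]) ^ (b + c)) * hUi
  rw [key]
  refine Submodule.sub_mem _ (Submodule.sub_mem _ ?_ ?_) ?_
  · exact Submodule.mem_sup_left (Ideal.mul_mem_left _ _ (Ideal.mem_span_singleton_self P))
  · exact Submodule.mem_sup_right (Ideal.mul_mem_left _ _ hP₁)
  · exact Submodule.mem_sup_right (hpJ_mem _)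

/-- The socle lemma with the norm element: `P ∉ I(n,J)`, `1 ≤ J` ⟹ `p^{J−1}·ν_{n/0} ∈ (P) + I(n,J)`, `ν_{n/0} = ∑_{i<pⁿ}(1+T)ⁱ`
(the transpose of `N_{n/0} = ∑ φⁱ`). [cite: Washington1997, §7.1 and §13.2] -/
theorem socle_geom_sum_mem_span_sup_omegaIdeal {J : ℕ} (hJ : 1 ≤ J) (n : ℕ) {P : PowerSeries ℤ_[p]}
    (hP : P ∉ Ideal.span {(((X + 1 : ℤ_[p][X]) ^ p ^ n - 1 : ℤ_[p][X]) : PowerSeries ℤ_[p])} ⊔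
      Ideal.span {PowerSeries.C ((p : ℤ_[p]) ^ J)}) :
    PowerSeries.C ((p : ℤ_[p]) ^ (J - 1)) * (∑ i ∈ Finset.range (p ^ n), (1 + PowerSeries.X : PowerSeries ℤ_[p]) ^ i) ∈
      Ideal.span {P} ⊔ (Ideal.span {(((X + 1 : ℤ_[p][X]) ^ p ^ n - 1 : ℤ_[p][X]) : PowerSeries ℤ_[p])} ⊔
        Ideal.span {PowerSeries.C ((p : ℤ_[p]) ^ J)}) := by
  obtain ⟨w, hw⟩ := C_dvd_geom_sum_sub_X_pow p n
  have e : PowerSeries.C ((p : ℤ_[p]) ^ (J - 1)) * (∑ i ∈ Finset.range (p ^ n), (1 + PowerSeries.X : PowerSeries ℤ_[p]) ^ i) =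
      PowerSeries.C ((p : ℤ_[p]) ^ (J - 1)) * (PowerSeries.X : PowerSeries ℤ_[p]) ^ (p ^ n - 1) +
        PowerSeries.C ((p : ℤ_[p]) ^ J) * w := by
    rw [show J = (J - 1) + 1 from (Nat.sub_add_cancel hJ).symm, pow_succ, map_mul, Nat.add_sub_cancel]
    linear_combination PowerSeries.C ((p : ℤ_[p]) ^ (J - 1)) * hw
  rw [e]
  exact Submodule.add_mem _ (socle_mem_span_sup_omegaIdeal p hJ n hP)
    (Submodule.mem_sup_right (Submodule.mem_sup_right (Ideal.mul_mem_right _ _ (Ideal.mem_span_singleton_self _))))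


end Socle

end Summit.BirchSwinnertonDyer.BirchSwinnertonDyer.Theorems.ResidualThetaLayer.PlusDual

end
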